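import Literature.AlgebraicGeometry.Resolution.BlowupAlgebraDerivations
import Literature.AlgebraicGeometry.Resolution.BlowupChartRsop
import HarnessLib

/-!
# δ-cut, stellar NC-HYP arm — the «JetCut» engine, RING LEVEL (T19a): logarithmic derivations extend through blow-up charts

[OURS · decomp-res-lens-6 g35 · column item `E1TopNoAbs` (stmt-ResolutionOfSingularities-26971)]

The one new ring-theoretic input of the «JetCut» law (T19b/c `DeltaCutStellarJet*.lean`): a derivation `δ` of `R` that is
LOGARITHMIC for the generators `c₁, …, c_k` of the centre `I = (c₁, …, c_k)` (`δ c_l ∈ (c_l)` for every `l`) extends to a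
derivation of every chart ring `R[I/c_j]` of the blowing up `Bl_I Spec R` COMPATIBLY WITH THE STRUCTURE MAP (no twist by
`c_j`: `D ∘ (R → R[I/c_j]) = (R → R[I/c_j]) ∘ δ`).  Formula: `D(x/c_j) = (δ x − b·x)/c_j` where `δ c_j = b·c_j`.

Derivations are handled as BARE FUNCTIONS with the predicate `IsDeriv` (additive + Leibniz): the typed class `JetAt` of T19b
quantifies over `δ : 𝒪_y → 𝒪_y` with `IsDeriv δ`, so that no `ℤ`-module instance path enters any statement; Mathlib's
`Derivation ℤ` is used only inside proofs over abstract rings (`IsDeriv.toDerivation`, `IsDeriv.exists_extend`).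

* `IsDeriv` + API (`map_one`, `map_pow_succ`, `map_pow_eq_zero_of_natCast`, `apply_mem_of_mem_sq`, log lemmas, `toDerivation`,
  `exists_extend` = Literature `exists_derivation_extend_of_isLocalization` in bare form, `comp_ringEquiv`);
* `exists_isDeriv_blowupAlgebra_of_log` — the extension to `blowupAlgebra I a` (model: Literature
  `exists_derivation_blowupAlgebra_of_apply_eq_zero`, the case `b = 0`);
* `exists_isDeriv_chartRing_of_log` — the same on the tree's chart ring `chartRing c j = (R[It])_{(c_j t)}` (along
  `reesChartEquiv`), the form consumed by `IsBlowup.exists_reesChart_stalk`.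

Fact-free, sorry-free. [folklore]
-/

noncomputable section

universe u

open Literature.AlgebraicGeometry.Resolution IsLocalization

namespace Summit.ResolutionOfSingularities.ResolutionOfSingularities.Theorems.DeltaCutClasses

/-- **an (absolute) derivation of a commutative ring, as a bare function**: additive and Leibniz. [folklore] -/
def IsDeriv {A : Type u} [CommRing A] (δ : A → A) : Prop :=
  (∀ a b, δ (a + b) = δ a + δ b) ∧ ∀ a b, δ (a * b) = a * δ b + b * δ a

namespace IsDeriv

variable {A : Type u} [CommRing A] {δ : A → A}

/-- Additivity of a bare derivation. [folklore] -/
theorem map_add (h : IsDeriv δ) (a b : A) : δ (a + b) = δ a + δ b := h.1 a b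

/-- The Leibniz rule of a bare derivation. [folklore] -/
theorem leibniz (h : IsDeriv δ) (a b : A) : δ (a * b) = a * δ b + b * δ a := h.2 a b

/-- the additive map. [folklore] -/
def addMonoidHom (h : IsDeriv δ) : A →+ A := AddMonoidHom.mk' δ h.1

/-- The additive-monoid-hom packaging evaluates to `δ`. [folklore] -/
@[simp] theorem addMonoidHom_apply (h : IsDeriv δ) (a : A) : h.addMonoidHom a = δ a := rfl

/-- `δ 0 = 0`. [folklore] -/
theorem map_zero (h : IsDeriv δ) : δ 0 = 0 := by simpa using h.addMonoidHom.map_zero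

/-- `δ (-a) = -δ a`. [folklore] -/
theorem map_neg (h : IsDeriv δ) (a : A) : δ (-a) = -δ a := by simpa using h.addMonoidHom.map_neg a

/-- `δ (a - b) = δ a - δ b`. [folklore] -/
theorem map_sub (h : IsDeriv δ) (a b : A) : δ (a - b) = δ a - δ b := by simpa using h.addMonoidHom.map_sub a b

/-- `δ 1 = 0` (Leibniz at `1 · 1`). [folklore] -/
theorem map_one (h : IsDeriv δ) : δ 1 = 0 := by
  have e := h.leibniz 1 1
  rw [one_mul, one_mul] at e
  linear_combination -e

/-- `δ` kills the naturals. [folklore] -/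
theorem map_natCast (h : IsDeriv δ) (n : ℕ) : δ n = 0 := by
  induction n with
  | zero => simpa using h.map_zero
  | succ n ih => rw [Nat.cast_succ, h.map_add, ih, h.map_one, zero_add]

/-- `δ (x^(n+1)) = (n+1)·xⁿ·δ x`. [folklore] -/
theorem map_pow_succ (h : IsDeriv δ) (x : A) (n : ℕ) : δ (x ^ (n + 1)) = (n + 1 : ℕ) * x ^ n * δ x := by
  induction n with
  | zero => simp
  | succ n ih =>
    rw [pow_succ, h.leibniz, ih]
    push_cast
    ring

/-- in characteristic dividing `p`, `δ (x^p) = 0`. [folklore] -/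
theorem map_pow_eq_zero_of_natCast {p : ℕ} (h : IsDeriv δ) (hp : (p : A) = 0) (x : A) : δ (x ^ p) = 0 := by
  rcases Nat.eq_zero_or_pos p with rfl | hpos
  · rw [pow_zero, h.map_one]
  · obtain ⟨n, rfl⟩ := Nat.exists_eq_add_one_of_ne_zero hpos.ne'
    rw [h.map_pow_succ, hp, zero_mul, zero_mul]

/-- `δ (u·v) ∈ (δ u) + (v)`-type bookkeeping: `δ (a * b) - a * δ b = b * δ a`. [folklore] -/
theorem leibniz_sub (h : IsDeriv δ) (a b : A) : δ (a * b) - a * δ b = b * δ a := by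
  rw [h.leibniz]; ring

/-- **every derivation maps `J²` into `J`.** [folklore] -/
theorem apply_mem_of_mem_sq (h : IsDeriv δ) (J : Ideal A) {x : A} (hx : x ∈ J ^ 2) : δ x ∈ J := by
  rw [pow_two] at hx
  induction hx using Submodule.mul_induction_on' with
  | mem_mul_mem a ha b hb =>
    rw [h.leibniz]
    exact Ideal.add_mem _ (Ideal.mul_mem_right _ _ ha) (Ideal.mul_mem_right _ _ hb)
  | add y _ z _ hy hz => rw [h.map_add]; exact Ideal.add_mem _ hy hz

/-- a derivation logarithmic for `a` (`δ a ∈ (a)`) maps `(a)` into `(a)`. [folklore] -/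
theorem apply_mem_span_singleton_of_log (h : IsDeriv δ) {a : A} (ha : δ a ∈ Ideal.span {a}) {g : A}
    (hg : g ∈ Ideal.span {a}) : δ g ∈ Ideal.span {a} := by
  obtain ⟨s, rfl⟩ := Ideal.mem_span_singleton'.mp hg
  rw [h.leibniz]
  exact Ideal.add_mem _ (Ideal.mul_mem_left _ _ ha) (Ideal.mul_mem_right _ _ (Ideal.mem_span_singleton_self a))

/-- a derivation logarithmic for every `c_l` maps `I = (c₁, …, c_k)` into `I`. [folklore] -/
theorem apply_mem_span_range_of_log (h : IsDeriv δ) {k : ℕ} (c : Fin k → A) (hlog : ∀ l, δ (c l) ∈ Ideal.span {c l})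
    {x : A} (hx : x ∈ Ideal.span (Set.range c)) : δ x ∈ Ideal.span (Set.range c) := by
  induction hx using Submodule.span_induction with
  | mem y hy =>
    obtain ⟨l, rfl⟩ := hy
    exact Ideal.span_mono (Set.singleton_subset_iff.mpr (Set.mem_range_self l)) (hlog l)
  | zero => rw [h.map_zero]; exact Submodule.zero_mem _
  | add y z _ _ hy hz => rw [h.map_add]; exact Ideal.add_mem _ hy hz
  | smul r y hy' hy =>
    rw [smul_eq_mul, h.leibniz]
    exact Ideal.add_mem _ (Ideal.mul_mem_left _ _ hy) (Ideal.mul_mem_right _ _ hy')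

/-- **transport along a ring isomorphism**: `e⁻¹ ∘ D ∘ e`. [folklore] -/
theorem comp_ringEquiv {B : Type u} [CommRing B] (e : A ≃+* B) {D : B → B} (hD : IsDeriv D) :
    IsDeriv fun x => e.symm (D (e x)) := by
  refine ⟨fun x y => ?_, fun x y => ?_⟩
  · show e.symm (D (e (x + y))) = e.symm (D (e x)) + e.symm (D (e y))
    rw [_root_.map_add, hD.map_add, _root_.map_add]
  · show e.symm (D (e (x * y))) = x * e.symm (D (e y)) + y * e.symm (D (e x))
    rw [_root_.map_mul, hD.leibniz, _root_.map_add, _root_.map_mul, _root_.map_mul, RingEquiv.symm_apply_apply,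
      RingEquiv.symm_apply_apply]

/-- the bare derivation as a Mathlib `ℤ`-derivation (abstract rings only). [folklore] -/
def toDerivation (h : IsDeriv δ) : Derivation ℤ A A :=
  Derivation.mk' h.addMonoidHom.toIntLinearMap fun a b => by
    simpa [smul_eq_mul] using h.leibniz a b

/-- The `Derivation ℤ A A` packaging evaluates to `δ`. [folklore] -/
@[simp] theorem toDerivation_apply (h : IsDeriv δ) (a : A) : h.toDerivation a = δ a := rfl

/-- a Mathlib derivation is a bare derivation. [folklore] -/
theorem of_derivation {k : Type*} [CommRing k] [Algebra k A] (D : Derivation k A A) : IsDeriv (D : A → A) :=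
  ⟨fun a b => _root_.map_add D a b, fun a b => by rw [D.leibniz, smul_eq_mul, smul_eq_mul]⟩

/-- **extension through a localization** (Literature `exists_derivation_extend_of_isLocalization`, bare form): a derivation of
`A` extends to every localization `S = M⁻¹A` compatibly with `algebraMap A S`. [cite: Matsumura1987, §25 p. 192] -/
theorem exists_extend (S : Type u) [CommRing S] [Algebra A S] (M : Submonoid A) [IsLocalization M S] (h : IsDeriv δ) :
    ∃ δ' : S → S, IsDeriv δ' ∧ ∀ a, δ' (algebraMap A S a) = algebraMap A S (δ a) := by
  obtain ⟨D, hD⟩ := exists_derivation_extend_of_isLocalization ℤ S M h.toDerivation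
  exact ⟨(D : S → S), of_derivation D, fun a => by simpa using hD a⟩

end IsDeriv

/-! ## The log extension to the affine blow-up algebra `R[I/a]` -/

section BlowupAlgebra

variable {R : Type u} [CommRing R] {I : Ideal R} {a : R}

/-- **LOG EXTENSION TO `R[I/a]`**: if `δ a = b·a` and `δ(I) ⊆ I`, the extension `δ̃` of `δ` to `R[1/a]` restricts to a
derivation `D` of `R[I/a]` with `D(r) = δ(r)` on `R` (`δ̃(x/a) = (δx − b x)/a ∈ R[I/a]` for `x ∈ I`). [folklore] -/
theorem exists_isDeriv_blowupAlgebra_of_log {δ : R → R} (hδ : IsDeriv δ) {b : R} (hab : δ a = b * a)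
    (hI : ∀ x ∈ I, δ x ∈ I) :
    ∃ D : blowupAlgebra I a → blowupAlgebra I a, IsDeriv D ∧
      ∀ r : R, D (algebraMap R (blowupAlgebra I a) r) = algebraMap R (blowupAlgebra I a) (δ r) := by
  set L := Localization.Away a
  obtain ⟨δ', hδ'd, hδ'⟩ := hδ.exists_extend L (Submonoid.powers a)
  -- `δ̃(x/a) = (δ x − b x)/a`
  have hgen : ∀ x : R, δ' (algebraMap R L x * Away.invSelf a) =
      algebraMap R L (δ x - b * x) * Away.invSelf a := by
    intro x
    have e1 : algebraMap R L x * Away.invSelf a * algebraMap R L a = algebraMap R L x := div_mul_algebraMap a x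
    have e2 : algebraMap R L a * Away.invSelf a = 1 := Away.mul_invSelf a
    have h := congrArg δ' e1
    rw [hδ'd.leibniz, hδ', hδ', hab, map_mul (algebraMap R L) b a] at h
    rw [map_sub, map_mul (algebraMap R L) b x]
    linear_combination (Away.invSelf a) * h
      - (δ' (algebraMap R L x * Away.invSelf a) + algebraMap R L b * algebraMap R L x * Away.invSelf a) * e2
  have hmem : ∀ y ∈ blowupAlgebra I a, δ' y ∈ blowupAlgebra I a := by
    intro y hy
    induction hy using Algebra.adjoin_induction with
    | mem y hy =>
      obtain ⟨x, hx, rfl⟩ := hy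
      rw [hgen x]
      exact div_mem_blowupAlgebra I a (I.sub_mem (hI x hx) (I.mul_mem_left b hx))
    | algebraMap r =>
      rw [hδ']
      exact Subalgebra.algebraMap_mem _ _
    | add y z _ _ hy hz =>
      rw [hδ'd.map_add]
      exact Subalgebra.add_mem _ hy hz
    | mul y z hy' hz' hy hz =>
      rw [hδ'd.leibniz]
      exact Subalgebra.add_mem _ (Subalgebra.mul_mem _ hy' hz) (Subalgebra.mul_mem _ hz' hy)
  refine ⟨fun y => ⟨δ' y, hmem y y.2⟩, ⟨fun y z => Subtype.ext (hδ'd.map_add _ _), fun y z => Subtype.ext (hδ'd.leibniz _ _)⟩,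
    fun r => Subtype.ext ?_⟩
  change δ' (algebraMap R L r) = algebraMap R L (δ r)
  rw [hδ']

end BlowupAlgebra

/-! ## The log extension to the chart ring `(R[It])_{(c_j t)}` -/

section ChartRing

variable {R : Type u} [CommRing R] {k : ℕ}

/-- **LOG EXTENSION TO THE CHART RING**: a derivation `δ` of `R` logarithmic for every generator `c_l` of
`I = (c₁, …, c_k)` extends to a derivation `D` of the chart ring `chartRing c j` of `Bl_I Spec R` with
`D ∘ chartBase = chartBase ∘ δ`. [folklore] -/
theorem exists_isDeriv_chartRing_of_log (c : Fin k → R) (j : Fin k) {δ : R → R} (hδ : IsDeriv δ)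
    (hlog : ∀ l, δ (c l) ∈ Ideal.span {c l}) :
    ∃ D : chartRing c j → chartRing c j, IsDeriv D ∧ ∀ r : R, D (chartBase c j r) = chartBase c j (δ r) := by
  have hj : c j ∈ Ideal.span (Set.range c) := Ideal.mem_span_range_self (f := c) (x := j)
  obtain ⟨b, hb⟩ := Ideal.mem_span_singleton'.mp (hlog j)
  obtain ⟨D, hDd, hD⟩ := exists_isDeriv_blowupAlgebra_of_log (I := Ideal.span (Set.range c)) (a := c j) hδ hb.symm
    (fun x hx => hδ.apply_mem_span_range_of_log c hlog hx)
  have hcomp := IsDeriv.comp_ringEquiv (A := chartRing c j)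
    (reesChartEquiv (I := Ideal.span (Set.range c)) (c j) hj) hDd
  refine ⟨_, hcomp, fun r => ?_⟩
  change (reesChartEquiv (c j) hj).symm (D (reesChartEquiv (c j) hj (reesChartBase (c j) hj r))) =
    reesChartBase (c j) hj (δ r)
  rw [reesChartEquiv_reesChartBase, hD, ← reesChartEquiv_reesChartBase (c j) hj (δ r), RingEquiv.symm_apply_apply]

end ChartRing

end Summit.ResolutionOfSingularities.ResolutionOfSingularities.Theorems.DeltaCutClasses

end
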